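import Summits.QuantumFields.YangMills.Theorems.BalabanUVNodesN22W1RelCentredNumeralsStrict

/-!
# BalabanUVNodes ∕ node N22 = NE9 — THE RELATIVE-DISC CENTRED ROAD OVER THE ADMISSIBLE CLASS, MODULE J14: THE KNIT's NUMERALS AT THE NUMERICS RECORD OF RECORD `consts`, AT THE
# JOINT WITNESS's LETTERS (`a₅ = 1∕5`, `ρ_b = 1∕100`, `Mv = 3∕2 > 1`), TOGETHER WITH THAT WITNESS's TWO CONDITIONS ON THE CONSTANTS — so that the knit J12-K's numerals and the
# located-antecedent witness J13 hold at ONE AND THE SAME constants record and ONE AND THE SAME letter set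

Cell `pub-ymgap`, HUMAN RULING D-0062 (Track A), R134 ACCELERATION re-seat `pub-ymgap-dag-n22-c` (strategy s1), generation 9, file J14.  THEOREMS ONLY; imports R4s
`…N22W1RelCentredNumeralsStrict` (through it R4, R2's slack lemma `two_mul_exp_le_exp_add_log_two`, module 17′ `…StripNumeralsAnyM` (`lemma3Numerics_consts_anyM`), module 17
`…StripNumerals` (`stripNumerics_consts`), dag-n18-c's `…N18HLayerW1NumeralsStrict` (`smallKP_consts_strict`) and `B13Lemma3TorusNonvacuity` (`consts`, `numerics_nonvacuous_pos_consts`))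
BY NAME.  `--supports` K3⁷ `SpineGivenEndpointR13SepCoPH` (stmt-QuantumFields-20544) as a helper.

WHY.  R4s witnesses the knit's numerals (J10c ∕ J12-K: `Lemma3Numerics c M (½L) a a₂ a₂′ a₅′ Aabs`, S25, the STRICT [KP86] clause, the renewal size `E₀`, the weight slack
`2e^{a₅|Z|} ≤ e^{a₅′|Z|}`, the apertures `0 < cA < cP < 1`, `cP∕(1−cP) < ρb < 1`, `0 < Mv`, `(1−cP)⁻²·Mv·((1+cA)γ)² ≤ ½`, `2(1−cP)⁻²Mv·E₀·(1+cA)² ≤ li.A`, the letter signs) with an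
`∃`-hidden constants record, `a₅ = ½ − log 2 < 0` and `Mv`, `ρb` depending on `γ`, `cP`.  Module J13's witness of the knit's LOCATED antecedent (`hlaw ∧ ιU` at one degenerate datum
family) needs, of the SAME `c`, `1 ≤ c.κ₁` and W1-8's `0 < invTau c d ≤ ½`, and produces records at the FIXED letters `a₅ = 1∕5`, `ρb = 1∕100`, any `Mv > 1`.  THIS FILE shows the two
fit ONE `c` and ONE letter set: at `c := consts` (the numerics record of record of `B13Lemma3TorusNonvacuity`) the socket accepts the weight exponent `a₅′ := 1∕5 + log 2`
(`habs : a₅′ + e^{−(κ₁−1)∕2} ≤ Aabs = 1` because `κ₁ − 1 = 36·(1 − 7δ)·4·κ ≥ 18` at the witness — `exp_neg_half_kappa1_le`), whence the slack at `a₅ = 1∕5`; the apertures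
`cA = 1∕400 < cP = 1∕200` give `cP∕(1−cP) = 1∕199 < 1∕100 = ρb`; `Mv := 3∕2 > 1` meets `(1−cP)⁻²·Mv·((1+cA)γ)² ≤ ½` for every window `γ ≤ ½` ([I] p. 263: `γ` is the
coupling bound `g₀`, small); and conjuncts 40–41 of `numerics_nonvacuous_pos_consts` ARE `1 ≤ consts.κ₁` and `0 < invTau consts d ≤ ½`.

WHAT.  `exp_neg_half_kappa1_le` (`e^{−(consts.κ₁−1)∕2} ≤ 1∕10`), `lemma3Numerics_consts_anyM_fifth` (`Lemma3Numerics consts M (½L) (aw + 40M) 1 1 (1∕5 + log 2) 1`), `consts_α₆_ne_zero`,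
★ `knitNumerals_consts_at_jointLetters`: for every `M` and every window `0 < γ ≤ ½`, `∃ li L a a₂ a₂′ a₅′ Aabs r₁ E₀`, EVERY numeric hypothesis of J12-K
`…_unscaledLawDatumLGU` at `c := consts`, `a₅ := 1∕5`, `ρb := 1∕100`, `Mv := 3∕2`, `cA := 1∕400`, `cP := 1∕200`, PLUS `1 < Mv`, `1 ≤ consts.κ₁`, `consts.α₆ ≠ 0` and
`∀ d ≥ 0, 0 < invTau consts d ≤ ½` (J13's two conditions) — read side by side with J13 `locatedAntecedent_inhabited consts … (Mv := 3∕2) … (a := a) (γ := γ)`: the knit's numerals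
AND its located antecedent (`hlaw ∧ ιU ∧ hWsp`) are inhabited at ONE constants record and ONE letter set.

HONEST FRAMING.  Count-neutral arithmetic (A-column bookkeeping): the knit J12-K's antecedent is thereby inhabited EXCEPT for the reading's table plumbing (`hspk`, `hrestr`, `hT₀`,
`hg`), the identification `hGn` and node N18 below the run (`h18`) — NOT witnessed, GAP-STATED; nothing of Bałaban's asserted; N22 NOT discharged; one finite four-torus programme at
fixed ε — NOT infinite volume, NOT OS on ℝ⁴, NOT a mass gap, NOT Clay.  0 `sorry`, 0 `def`, standard axioms.

References (TYPES only): [II] = [Balaban1988RG2Cluster] (2.15) p. 15, (2.18) p. 16, (2.24)–(2.26) p. 17, Lemma 3 p. 20, (2.39)–(2.41) p. 21 and the closing paragraph p. 21; [I] =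
[Balaban1987RG1] §1 p. 263, (2.9)–(2.10) pp. 266–267; [KP86] as cited in R4.
-/

noncomputable section

namespace YMDAG.N22.W1

open Set Metric
open scoped BigOperators
open Literature.MathematicalPhysics.QuantumFieldTheory.Balaban1983to89
open Literature.MathematicalPhysics.QuantumFieldTheory.Balaban1983to89.TreeLengthTorus (TDom)
open Literature.MathematicalPhysics.QuantumFieldTheory.Balaban1983to89.B12TreeDecay (K₀ K₀_pos kappa₀_nonneg)
open Literature.MathematicalPhysics.QuantumFieldTheory.Balaban1983to89.B13Lemma3TorusSocket (Lemma3Numerics)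
open Literature.MathematicalPhysics.QuantumFieldTheory.Balaban1983to89.B13Lemma3WindowNonvacuity (Kw κ₀w κw δw μw α₆w aw)
open Literature.MathematicalPhysics.QuantumFieldTheory.Balaban1983to89.B13Lemma3TorusNonvacuity (consts numerics_nonvacuous_pos_consts consts_L κ₁t)
open Literature.MathematicalPhysics.QuantumFieldTheory.Balaban1983to89.B13Bound143 (invTau)
open Literature.MathematicalPhysics.QuantumFieldTheory.Balaban1983to89.Node00.W1 (LetterInputs)
open Summit.QuantumFields.YangMills.BalabanUVNodes.N18HLayerW1NumeralsStrict (smallKP_consts_strict)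

/-! ## §1 The socket accepts the weight exponent `1∕5 + log 2` at the numerics record of record -/

/-- **`e^{−(κ₁ − 1)∕2} ≤ 1∕10` AT THE WITNESS**: `consts.κ₁ = 1 + 36·μw`, `μw = (1 − 7·(3∕40))·4·κw`, `κw = 20(κ₀(64,8) + 64) ≥ 1280`, so `(κ₁ − 1)∕2 = 18μw ≥ 9` and
`e^{−9} ≤ 1∕(1 + 9)`. [cite: Balaban1988RG2Cluster, p.20 (restriction on κ₁) and p.21 (closing paragraph)] (arithmetic at the witness) -/
theorem exp_neg_half_kappa1_le : Real.exp (-((consts.κ₁ - 1) / 2)) ≤ 1 / 10 := by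
  have hκ₁ : consts.κ₁ = 1 + 36 * μw := rfl
  have hκ₀ : 0 ≤ κ₀w := kappa₀_nonneg (by norm_num) _
  have hμ : (1 / 2 : ℝ) ≤ μw := by
    show (1 / 2 : ℝ) ≤ (1 - 7 * δw) * 4 * κw
    simp only [δw, κw]
    nlinarith
  have h9 : -((consts.κ₁ - 1) / 2) ≤ -9 := by rw [hκ₁]; linarith
  calc Real.exp (-((consts.κ₁ - 1) / 2)) ≤ Real.exp (-9) := Real.exp_le_exp.2 h9
    _ ≤ 1 / 10 := by
        have h := Real.add_one_le_exp (9 : ℝ)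
        rw [Real.exp_neg, inv_le_comm₀ (Real.exp_pos _) (by norm_num)]
        linarith

/-- **THE SOCKET LETTERS AT EVERY `M` WITH THE WEIGHT EXPONENT `a₅′ = 1∕5 + log 2`**: module 17′'s `Lemma3Numerics consts M (½L) (aw + 40M) 1 1 ½ 1` with its two `a₅`-clauses
re-proved at `1∕5 + log 2` (`0 ≤ a₅′`; `a₅′ + e^{−(κ₁−1)∕2} ≤ 1` from §1 and `log 2 < 0.6931471808`) — every other clause of the structure is `a₅`-free.
[cite: Balaban1988RG2Cluster, Lemma 3 p.20, (2.39)-(2.41) p.21 and the closing paragraph p.21] -/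
theorem lemma3Numerics_consts_anyM_fifth (M : ℕ) : Lemma3Numerics consts M ((consts.L : ℝ) / 2) (aw + 40 * (M : ℝ)) 1 1 (1 / 5 + Real.log 2) 1 :=
  { lemma3Numerics_consts_anyM M with
    ha₅ := by positivity
    habs := by
      have h1 := exp_neg_half_kappa1_le
      have h2 := Real.log_two_lt_d9
      linarith }

/-- **`consts.α₆ ≠ 0`** (`α₆w = (e·K₀(64,8)·64)⁻¹ > 0`; the knit's `hα₆`). [cite: Balaban1988RG2Cluster, (2.29) p.18 (the smallness fixing α₆)] (arithmetic at the witness) -/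
theorem consts_α₆_ne_zero : consts.α₆ ≠ 0 := by
  show α₆w ≠ 0
  have hK : 0 < Kw := K₀_pos 64 8
  have : 0 < α₆w := by unfold α₆w; positivity
  exact this.ne'

/-! ## §2 The knit's numerals at `consts` and the joint witness's letters -/

/-- **★ THE KNIT's NUMERALS AT THE NUMERICS RECORD OF RECORD, AT THE JOINT WITNESS's LETTERS** — for every bond-cube parameter `M` and every window `0 < γ ≤ ½`: letter inputs
`li := ⟨consts.κ, ½, 0, 0, 0, 1, 7, 1, 1∕400, ½⟩`, block factor `L := consts.L = 8`, socket letters `(aw + 40M, 1, 1, 1∕5 + log 2, 1)`, `r₁ := consts.κ`, `E₀ := consts.E₀ = 2`, and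
— NOT hidden — `c := consts`, `a₅ := 1∕5`, `cA := 1∕400`, `cP := 1∕200`, `ρb := 1∕100`, `Mv := 3∕2`: the letter signs, `Lemma3Numerics`, S25, the STRICT [KP86] clause
(dag-n18-c `smallKP_consts_strict`), the renewal size, the weight slack `2e^{|Z|∕5} ≤ e^{(1∕5 + log 2)|Z|}`, the apertures with `cP∕(1−cP) < ρb < 1`, `0 < Mv`, `1 < Mv`,
`(1−cP)⁻²·Mv·((1+cA)γ)² ≤ ½` (uses `γ ≤ ½`), `2(1−cP)⁻²Mv·E₀·(1+cA)² ≤ li.A`, `li.r ≤ min cA 1`, `1 ≤ consts.κ₁`, `consts.α₆ ≠ 0`, and W1-8's `0 < invTau consts d ≤ ½` for `d ≥ 0`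
— i.e. EVERY numeric hypothesis of J12-K `…_unscaledLawDatumLGU` and BOTH conditions of J13 `locatedAntecedent_inhabited`, at once.
[cite: Balaban1988RG2Cluster, (2.15) p.15, (2.24)-(2.26) p.17, Lemma 3 p.20, (2.39)-(2.41) p.21; Balaban1987RG1, §1 p.263, (2.9)-(2.10) pp.266-267] -/
theorem knitNumerals_consts_at_jointLetters (M : ℕ) {γ : ℝ} (hγ : 0 < γ) (hγh : γ ≤ 1 / 2) :
    ∃ (li : LetterInputs) (L : ℕ) (a a₂ a₂' a₅' Aabs r₁ E₀ : ℝ),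
      (0 < li.C₀ ∧ 0 < li.θ₅ ∧ li.θ₅ < 1 ∧ 0 ≤ li.C₅ ∧ 2 * li.C₅ / (1 - li.θ₅) ≤ li.C₀ ∧ 0 < li.A ∧ li.μ = 1 ∧ 0 < li.r ∧ li.s = (2 : ℝ)⁻¹) ∧
      8 ≤ consts.L ∧ consts.L = L ∧ Lemma3Numerics consts M ((consts.L : ℝ) / 2) a a₂ a₂' a₅' Aabs ∧ 0 ≤ consts.C3act * consts.ε₁ ∧ 0 ≤ r₁ ∧ li.κ ≤ r₁ ∧
      r₁ + 2 * (64 * Real.log 162) + 2 ≤ (1 - 8 * consts.δ) * ((consts.L : ℝ) / 2) * consts.κ ∧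
      consts.C3act * consts.ε₁ * Real.exp (5 * r₁ + 1) * K₀ 64 8 * 9 * 64 < 1 ∧
      Real.exp 1 * 9 * 64 * K₀ 64 8 ^ 2 * (consts.C3act * consts.ε₁) ≤ E₀ ∧
      (∀ {d n : ℕ} [NeZero n] (Z : TDom d n), 2 * Real.exp ((1 / 5 : ℝ) * ((Z.1).card : ℝ)) ≤ Real.exp (a₅' * ((Z.1).card : ℝ))) ∧
      (0 : ℝ) < 1 / 400 ∧ (1 / 400 : ℝ) < 1 / 200 ∧ (1 / 200 : ℝ) < 1 ∧ (1 / 200 : ℝ) / (1 - 1 / 200) < 1 / 100 ∧ (1 / 100 : ℝ) < 1 ∧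
      (0 : ℝ) < 3 / 2 ∧ (1 : ℝ) < 3 / 2 ∧ (1 - 1 / 200 : ℝ)⁻¹ ^ 2 * (3 / 2) * ((1 + 1 / 400) * γ) ^ 2 ≤ 1 / 2 ∧
      2 * ((1 - 1 / 200 : ℝ)⁻¹ ^ 2 * (3 / 2)) * E₀ * (1 + 1 / 400) ^ 2 ≤ li.A ∧ li.r ≤ min (1 / 400 : ℝ) 1 ∧
      1 ≤ consts.κ₁ ∧ consts.α₆ ≠ 0 ∧ (∀ d : ℝ, 0 ≤ d → 0 < invTau consts d ∧ invTau consts d ≤ 1 / 2) := by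
  obtain ⟨hL, -, hC3pos, hκ, hκr, hlarge, -, hrenew⟩ := stripNumerics_consts
  obtain ⟨-, -, -, -, -, -, -, -, -, -, -, -, -, -, -, -, -, -, -, -, -, -, -, -, -, -, -, -, -, -, -, -, -, -, -, -, -, -, -, hκ₁, hinv⟩ :=
    numerics_nonvacuous_pos_consts
  have hE₀ : consts.E₀ = 2 := rfl
  have hγ2 : γ ^ 2 ≤ 1 / 4 := by nlinarith
  refine ⟨⟨consts.κ, 1 / 2, 0, 0, 0, 1, 7, 1, 1 / 400, (2 : ℝ)⁻¹⟩, consts.L, aw + 40 * (M : ℝ), 1, 1, 1 / 5 + Real.log 2, 1, consts.κ, consts.E₀,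
    ?_, hL, rfl, lemma3Numerics_consts_anyM_fifth M, hC3pos, hκ, hκr, hlarge, smallKP_consts_strict, hrenew, fun Z => two_mul_exp_le_exp_add_log_two (1 / 5) Z,
    by norm_num, by norm_num, by norm_num, by norm_num, by norm_num, by norm_num, by norm_num, ?_, ?_, by norm_num, hκ₁, consts_α₆_ne_zero, hinv⟩
  · exact ⟨by norm_num, by norm_num, by norm_num, le_rfl, by norm_num, by norm_num, rfl, by norm_num, rfl⟩
  · nlinarith [hγ2, sq_nonneg γ]
  · rw [hE₀]; norm_num

end YMDAG.N22.W1

end
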